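import Summits.AtomisticToContinuum.BoseEinsteinCondensation.Theorems.BECCutLineWeakDisorderGroundStateRigidityStubClosedEnergyTruncHardCoreAux
import Literature.MathematicalPhysics.QuantumManyBody.BoseGasHardCoreContact
import HarnessLib

/-!
# Crux `GroundStateRigidity` (stmt-AtomisticToContinuum-9072), line `zoo_reduction`:
# helpers for the registered stub `stub_wallCut` — the wall-shell Poincaré inequality

Supports (does not close) stmt-AtomisticToContinuum-9072; auxiliary file of the registered stub
`stub_wallCut` (CUT) of line `zoo_reduction` (lead c5), imported by
`BECCutLineWeakDisorderGroundStateRigidityStubWallCut.lean`. **Mass of a wave function in a thin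
pair shell containing a sphere on which it vanishes.** For a `C¹` function `ψ` on `(ℝ³)^N`, a pair
`i ≠ j`, radii `0 < a`, `0 < δ ≤ a/20` and a WALL radius `r₀ ∈ [a, a + δ]` such that `ψ = 0`
wherever `|xᵢ - xⱼ| = r₀` (e.g. a hard radius of the pair potential, on whose sphere every
finite-energy wave function vanishes):

  `∫ 1{a < |xᵢ-xⱼ| < a+δ} |ψ|² ≤ 9 δ² ∫ 1{a < |xᵢ-xⱼ| < a+δ} ∑ₖ |∂_{ik} ψ|²`
  (`WallCut.lintegral_wallShell_le`, and `≤ 9 δ² ∫ 1{shell} |∇ψ|²`,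
  `WallCut.lintegral_wallShell_le_kinetic`).

This is the one-pair shell estimate `lintegral_shellPair_le` of
`Literature/…/BoseGasHardCoreContact.lean` (there the zero sits at the inner radius `a`, coming from
a hard core `{|xᵢ - xⱼ| ≤ a}`) with the zero moved to an arbitrary radius `r₀` INSIDE the shell; the
proofs are adapted line by line: the shell is covered by the six coordinate cones
(`indicator_shellPair_le_sum`), each coordinate line crosses the cone part of the shell in an
interval of parameter length `≤ 3δ` (`shell_fibre_geometry`) which contains the parameter
`√(r₀² - ρ²)` of the wall crossing, where the fibre function vanishes, so the one-dimensional
Poincaré inequality `poincare_Ioo_of_zero` applies on that interval; then Fubini along the lines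
(`lintegral_le_of_forall_line`) and the sum over the cones. Summing over the ordered pairs gives
the WALL-LAYER bound `WallCut.lintegral_wallLayer_le`: if `ψ` vanishes wherever some pair is at
distance `r₀`, its mass in `{∃ i ≠ j, a < |xᵢ - xⱼ| < a + δ}` is `≤ N² · 9δ² ×` (its kinetic
energy in that layer) (`WallCut.measurableSet_pairShells`, `WallCut.lintegral_pairShells_le` and
`ClosedEnergyTrunc.sum_sum_le` of the landed `…StubClosedEnergyTruncHardCoreAux.lean`).
-/

noncomputable section

open MeasureTheory Set Metric
open scoped ENNReal NNReal

namespace Summit.AtomisticToContinuum.BoseEinsteinCondensation.Theorems.GroundStateRigidity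

open Literature.MathematicalPhysics.QuantumManyBody.BoseGas

namespace WallCut

variable {N : ℕ} {a δ r₀ : ℝ}

/-- **The wall-shell estimate on a coordinate line.** For a `C¹` wave function vanishing on the
sphere `|xᵢ - xⱼ| = r₀`, `a ≤ r₀ ≤ a + δ`, `δ ≤ a`, on every line parallel to `e_{i,k}` the mass in
the cone part of the shell `a < |xᵢ - xⱼ| < a + δ` is at most `9δ²` times the `e_{i,k}`-derivative
energy in the half-shell: the line crosses the cone part in an interval of length `≤ 3δ` containing
the wall crossing, where the fibre function vanishes (one-dimensional Poincaré). [folklore] -/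
theorem lintegral_line_wallCone_le (ha : 0 < a) (hδ : 0 < δ) (hδa : δ ≤ a) (har : a ≤ r₀)
    (hra : r₀ ≤ a + δ) {ψ : Config N → ℂ} (hψ : ContDiff ℝ 1 ψ) {i j : Fin N} (hij : i ≠ j)
    (hzero : ∀ X : Config N, dist (X i) (X j) = r₀ → ψ X = 0)
    (k : Fin 3) {σ : ℝ} (hσ : σ = 1 ∨ σ = -1) (X : Config N) (y : Fin 3 → ℝ) :
    ∫⁻ t, (shellPairCone a δ i j k σ).indicator (fun X => (‖ψ X‖₊ : ℝ≥0∞) ^ 2)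
        (linePoint X i y k t) ≤
      ENNReal.ofReal (9 * δ ^ 2) *
        ∫⁻ t, (shellPairSign a δ i j k σ).indicator
          (fun X => (‖fderiv ℝ ψ X (unitVec i k)‖₊ : ℝ≥0∞) ^ 2) (linePoint X i y k t) := by
  -- adapted from `lintegral_line_shellPairCone_le` of
  -- Literature/MathematicalPhysics/QuantumManyBody/BoseGasHardCoreContact.lean (zero moved to `r₀`)
  -- the fibre functions
  set L : ℝ → Config N := linePoint X i y k with hL
  set φ : ℝ → ℂ := fun t => ψ (L t) with hφ
  set φ' : ℝ → ℂ := fun t => fderiv ℝ ψ (L t) (unitVec i k) with hφ'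
  have hLeq : L = fun t => linePoint X i y k 0 + t • unitVec i k :=
    funext fun t => linePoint_eq_add_smul X i y k t
  have hLcont : Continuous L := by rw [hLeq]; fun_prop
  have hderiv : ∀ t, HasDerivAt φ (φ' t) t := by
    intro t
    have hline : HasDerivAt (fun s : ℝ => linePoint X i y k 0 + s • unitVec i k)
        (unitVec i k) t := by
      simpa using ((hasDerivAt_id t).smul_const (unitVec i k)).const_add (linePoint X i y k 0)
    have hψd : HasFDerivAt ψ (fderiv ℝ ψ (L t)) (linePoint X i y k 0 + t • unitVec i k) := by
      rw [← linePoint_eq_add_smul]; exact (hψ.differentiable one_ne_zero _).hasFDerivAt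
    have hcomp := hψd.comp_hasDerivAt t hline
    have hfun : (ψ ∘ fun s : ℝ => linePoint X i y k 0 + s • unitVec i k) = φ := by
      funext s; simp [φ, L, ← linePoint_eq_add_smul]
    rwa [hfun] at hcomp
  have hcont' : Continuous φ' :=
    ((hψ.continuous_fderiv one_ne_zero).comp hLcont).clm_apply continuous_const
  -- fibre coordinates
  have hji : j ≠ i := fun h => hij h.symm
  set c : ℝ := X j k with hc
  set ρ2 : ℝ := ∑ k' ∈ Finset.univ.erase k, (y k' - X j k') ^ 2 with hρ2
  have hdist : ∀ t, dist (L t i) (L t j) ^ 2 = (t - c) ^ 2 + ρ2 := fun t =>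
    dist_linePoint_sq X hji y k t
  have hsub : ∀ t, L t i k - L t j k = t - c := fun t => linePoint_sub_apply X hji y k t
  by_cases hρa : ρ2 ≤ 3 * a ^ 2 / 4
  swap
  · -- the line misses the cone part
    have hempty : ∀ t, L t ∉ shellPairCone a δ i j k σ := by
      intro t ht
      have h2 := ht.2
      rw [hdist, hsub] at h2
      exact hρa (by linarith)
    simp [indicator_of_notMem (hempty _)]
  obtain ⟨hs0a, hs01, hdiffle, hs0sq, hs1sq⟩ := shell_fibre_geometry ha hδ hδa hρa
  set s₀ := √(a ^ 2 - ρ2) with hs₀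
  set s₁ := √((a + δ) ^ 2 - ρ2) with hs₁
  -- the parameter of the wall crossing, between the entry and exit parameters
  set sz := √(r₀ ^ 2 - ρ2) with hsz
  have hr₀0 : 0 ≤ r₀ := ha.le.trans har
  have hzsq : sz ^ 2 = r₀ ^ 2 - ρ2 := Real.sq_sqrt (by nlinarith)
  have hs0z : s₀ ≤ sz := Real.sqrt_le_sqrt (by nlinarith)
  have hsz1 : sz ≤ s₁ := Real.sqrt_le_sqrt (by nlinarith)
  -- wall parameter ⇒ zero of `φ`
  have hcontact : ∀ t, (t - c) ^ 2 = sz ^ 2 → φ t = 0 := by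
    intro t ht
    apply hzero
    have h := hdist t
    rw [ht, hzsq, sub_add_cancel] at h
    exact (pow_left_inj₀ dist_nonneg hr₀0 two_ne_zero).1 h
  -- membership in the cone part / half-shell along the line, in terms of `u = t - c`
  have hmem_cone : ∀ t, L t ∈ shellPairCone a δ i j k σ →
      a ^ 2 < (t - c) ^ 2 + ρ2 ∧ (t - c) ^ 2 + ρ2 < (a + δ) ^ 2 ∧ 0 < σ * (t - c) := by
    intro t ht
    obtain ⟨⟨⟨h1, h2⟩, h3⟩, -⟩ := ht
    rw [hsub] at h3
    refine ⟨?_, ?_, h3⟩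
    · rw [← hdist]; exact pow_lt_pow_left₀ h1 ha.le two_ne_zero
    · rw [← hdist]; exact pow_lt_pow_left₀ h2 dist_nonneg two_ne_zero
  have hmem_sign : ∀ t, a ^ 2 < (t - c) ^ 2 + ρ2 → (t - c) ^ 2 + ρ2 < (a + δ) ^ 2 →
      0 < σ * (t - c) → L t ∈ shellPairSign a δ i j k σ := by
    intro t h1 h2 h3
    refine ⟨⟨?_, ?_⟩, by rwa [hsub]⟩
    · exact lt_of_pow_lt_pow_left₀ 2 dist_nonneg (by rw [hdist]; exact h1)
    · exact lt_of_pow_lt_pow_left₀ 2 (by linarith) (by rw [hdist]; exact h2)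
  -- the interval `(lo, hi)` containing the cone fibre, contained in the half-shell fibre
  obtain ⟨lo, hi, tz, hlohi, htz, hzero', hcone_sub, hsub_sign⟩ :
      ∃ lo hi tz : ℝ, hi - lo ≤ 3 * δ ∧ tz ∈ Icc lo hi ∧ φ tz = 0 ∧
        (∀ t, L t ∈ shellPairCone a δ i j k σ → t ∈ Ioo lo hi) ∧
        (∀ t ∈ Ioo lo hi, L t ∈ shellPairSign a δ i j k σ) := by
    rcases hσ with rfl | rfl
    · refine ⟨c + s₀, c + s₁, c + sz, by linarith, ⟨by linarith, by linarith⟩,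
        hcontact _ (by ring), ?_, ?_⟩
      · intro t ht
        obtain ⟨h1, h2, h3⟩ := hmem_cone t ht
        rw [one_mul] at h3
        have hlt1 : s₀ < t - c := lt_of_pow_lt_pow_left₀ 2 h3.le (by linarith)
        have hlt2 : t - c < s₁ := lt_of_pow_lt_pow_left₀ 2 (by linarith) (by linarith)
        exact ⟨by linarith, by linarith⟩
      · intro t ht
        have hu1 : s₀ < t - c := by linarith [ht.1]
        have hu2 : t - c < s₁ := by linarith [ht.2]
        have hu : 0 < t - c := by linarith
        have hsq1 : s₀ ^ 2 < (t - c) ^ 2 := pow_lt_pow_left₀ hu1 (by linarith) two_ne_zero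
        have hsq2 : (t - c) ^ 2 < s₁ ^ 2 := pow_lt_pow_left₀ hu2 hu.le two_ne_zero
        exact hmem_sign t (by linarith) (by linarith) (by linarith)
    · refine ⟨c - s₁, c - s₀, c - sz, by linarith, ⟨by linarith, by linarith⟩,
        hcontact _ (by ring), ?_, ?_⟩
      · intro t ht
        obtain ⟨h1, h2, h3⟩ := hmem_cone t ht
        have h3' : 0 < c - t := by linarith
        have hlt1 : s₀ < c - t :=
          lt_of_pow_lt_pow_left₀ 2 h3'.le (by nlinarith)
        have hlt2 : c - t < s₁ := lt_of_pow_lt_pow_left₀ 2 (by linarith) (by nlinarith)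
        exact ⟨by linarith, by linarith⟩
      · intro t ht
        have hu1 : s₀ < c - t := by linarith [ht.2]
        have hu2 : c - t < s₁ := by linarith [ht.1]
        have hu : 0 < c - t := by linarith
        have hsq1 : s₀ ^ 2 < (c - t) ^ 2 := pow_lt_pow_left₀ hu1 (by linarith) two_ne_zero
        have hsq2 : (c - t) ^ 2 < s₁ ^ 2 := pow_lt_pow_left₀ hu2 hu.le two_ne_zero
        have hsq : (t - c) ^ 2 = (c - t) ^ 2 := by ring
        exact hmem_sign t (by linarith) (by linarith) (by linarith)
  -- conclusion: Poincaré on `(lo, hi)`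
  calc ∫⁻ t, (shellPairCone a δ i j k σ).indicator (fun X => (‖ψ X‖₊ : ℝ≥0∞) ^ 2) (L t)
      ≤ ∫⁻ t, (Ioo lo hi).indicator (fun t => (‖φ t‖₊ : ℝ≥0∞) ^ 2) t := by
        refine lintegral_mono fun t => ?_
        by_cases ht : L t ∈ shellPairCone a δ i j k σ
        · rw [indicator_of_mem ht, indicator_of_mem (hcone_sub t ht)]
        · rw [indicator_of_notMem ht]; exact zero_le
    _ = ∫⁻ t in Ioo lo hi, (‖φ t‖₊ : ℝ≥0∞) ^ 2 := lintegral_indicator measurableSet_Ioo _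
    _ ≤ ENNReal.ofReal ((hi - lo) ^ 2) * ∫⁻ t in Ioo lo hi, (‖φ' t‖₊ : ℝ≥0∞) ^ 2 :=
        poincare_Ioo_of_zero htz hzero' hderiv hcont'
    _ ≤ ENNReal.ofReal (9 * δ ^ 2) * ∫⁻ t, (shellPairSign a δ i j k σ).indicator
          (fun X => (‖fderiv ℝ ψ X (unitVec i k)‖₊ : ℝ≥0∞) ^ 2) (L t) := by
        have hlen : 0 ≤ hi - lo := by linarith [htz.1, htz.2]
        refine mul_le_mul' (ENNReal.ofReal_le_ofReal (by nlinarith)) ?_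
        rw [← lintegral_indicator measurableSet_Ioo]
        refine lintegral_mono fun t => ?_
        by_cases ht : t ∈ Ioo lo hi
        · rw [indicator_of_mem ht, indicator_of_mem (hsub_sign t ht)]
        · rw [indicator_of_notMem ht]; exact zero_le

/-- The wall-shell estimate for one pair and one cone, on configuration space (Fubini over the
lines parallel to `e_{i,k}`). [folklore] -/
theorem lintegral_wallCone_le (ha : 0 < a) (hδ : 0 < δ) (hδa : δ ≤ a) (har : a ≤ r₀)
    (hra : r₀ ≤ a + δ) {ψ : Config N → ℂ} (hψ : ContDiff ℝ 1 ψ) {i j : Fin N} (hij : i ≠ j)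
    (hzero : ∀ X : Config N, dist (X i) (X j) = r₀ → ψ X = 0)
    (k : Fin 3) {σ : ℝ} (hσ : σ = 1 ∨ σ = -1) :
    ∫⁻ X, (shellPairCone a δ i j k σ).indicator (fun X => (‖ψ X‖₊ : ℝ≥0∞) ^ 2) X ≤
      ENNReal.ofReal (9 * δ ^ 2) * ∫⁻ X, (shellPairSign a δ i j k σ).indicator
          (fun X => (‖fderiv ℝ ψ X (unitVec i k)‖₊ : ℝ≥0∞) ^ 2) X := by
  -- adapted from `lintegral_shellPairCone_le` of Literature/…/BoseGasHardCoreContact.lean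
  have hF : Measurable fun X => (shellPairCone a δ i j k σ).indicator
      (fun X => (‖ψ X‖₊ : ℝ≥0∞) ^ 2) X :=
    (measurable_ennnormSq hψ.continuous).indicator (measurableSet_shellPairCone a δ i j k σ)
  have hG : Measurable fun X => (shellPairSign a δ i j k σ).indicator
      (fun X => (‖fderiv ℝ ψ X (unitVec i k)‖₊ : ℝ≥0∞) ^ 2) X :=
    (measurable_ennnormSq_fderiv_apply hψ _).indicator (measurableSet_shellPairSign a δ i j k σ)
  rw [← lintegral_const_mul _ hG]
  refine lintegral_le_of_forall_line i k hF (measurable_const.mul hG) fun X y => ?_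
  rw [lintegral_const_mul _ (show Measurable (fun t => (shellPairSign a δ i j k σ).indicator
      (fun X => (‖fderiv ℝ ψ X (unitVec i k)‖₊ : ℝ≥0∞) ^ 2) (linePoint X i y k t)) from
    hG.comp (continuous_linePoint X i y k).measurable)]
  exact lintegral_line_wallCone_le ha hδ hδa har hra hψ hij hzero k hσ X y

/-- **The wall-shell estimate for one pair**: if the `C¹` wave function `ψ` vanishes on the sphere
`|xᵢ - xⱼ| = r₀` with `a ≤ r₀ ≤ a + δ` and `δ ≤ a/20`, then its mass on the shell
`a < |xᵢ - xⱼ| < a + δ` is at most `9δ²` times the `∇ᵢ`-energy on the same shell. [folklore] -/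
theorem lintegral_wallShell_le (ha : 0 < a) (hδ : 0 < δ) (hδa : 20 * δ ≤ a) (har : a ≤ r₀)
    (hra : r₀ ≤ a + δ) {ψ : Config N → ℂ} (hψ : ContDiff ℝ 1 ψ) {i j : Fin N} (hij : i ≠ j)
    (hzero : ∀ X : Config N, dist (X i) (X j) = r₀ → ψ X = 0) :
    ∫⁻ X, (shellPair a δ i j).indicator (fun X => (‖ψ X‖₊ : ℝ≥0∞) ^ 2) X ≤
      ENNReal.ofReal (9 * δ ^ 2) * ∫⁻ X, (shellPair a δ i j).indicator
          (fun X => ∑ k : Fin 3, (‖fderiv ℝ ψ X (unitVec i k)‖₊ : ℝ≥0∞) ^ 2) X := by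
  -- adapted from `lintegral_shellPair_le` of Literature/…/BoseGasHardCoreContact.lean
  have hδa' : δ ≤ a := by linarith
  set f := fun X : Config N => (‖ψ X‖₊ : ℝ≥0∞) ^ 2 with hf_def
  set g := fun (k : Fin 3) (X : Config N) => (‖fderiv ℝ ψ X (unitVec i k)‖₊ : ℝ≥0∞) ^ 2
    with hg_def
  have hf : Measurable f := measurable_ennnormSq hψ.continuous
  have hg : ∀ k, Measurable (g k) := fun k => measurable_ennnormSq_fderiv_apply hψ _
  have hmc : ∀ k σ, Measurable fun X => (shellPairCone a δ i j k σ).indicator f X :=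
    fun k σ => hf.indicator (measurableSet_shellPairCone a δ i j k σ)
  have hms : ∀ k σ, Measurable fun X => (shellPairSign a δ i j k σ).indicator (g k) X :=
    fun k σ => (hg k).indicator (measurableSet_shellPairSign a δ i j k σ)
  calc ∫⁻ X, (shellPair a δ i j).indicator f X
      ≤ ∫⁻ X, ∑ k : Fin 3, ((shellPairCone a δ i j k 1).indicator f X +
          (shellPairCone a δ i j k (-1)).indicator f X) :=
        lintegral_mono fun X => indicator_shellPair_le_sum ha hδa i j f X
    _ = ∑ k : Fin 3, ((∫⁻ X, (shellPairCone a δ i j k 1).indicator f X) +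
          ∫⁻ X, (shellPairCone a δ i j k (-1)).indicator f X) := by
        rw [lintegral_finsetSum _ fun k _ =>
          show Measurable (fun X => (shellPairCone a δ i j k 1).indicator f X +
            (shellPairCone a δ i j k (-1)).indicator f X) from (hmc k 1).add (hmc k (-1))]
        exact Finset.sum_congr rfl fun k _ => lintegral_add_left (hmc k 1) _
    _ ≤ ∑ k : Fin 3, (ENNReal.ofReal (9 * δ ^ 2) *
          (∫⁻ X, (shellPairSign a δ i j k 1).indicator (g k) X) +
          ENNReal.ofReal (9 * δ ^ 2) *
            ∫⁻ X, (shellPairSign a δ i j k (-1)).indicator (g k) X) :=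
        Finset.sum_le_sum fun k _ => add_le_add
          (lintegral_wallCone_le ha hδ hδa' har hra hψ hij hzero k (Or.inl rfl))
          (lintegral_wallCone_le ha hδ hδa' har hra hψ hij hzero k (Or.inr rfl))
    _ = ENNReal.ofReal (9 * δ ^ 2) * ∫⁻ X, ∑ k : Fin 3,
          ((shellPairSign a δ i j k 1).indicator (g k) X +
            (shellPairSign a δ i j k (-1)).indicator (g k) X) := by
        rw [lintegral_finsetSum _ fun k _ =>
          show Measurable (fun X => (shellPairSign a δ i j k 1).indicator (g k) X +
            (shellPairSign a δ i j k (-1)).indicator (g k) X) from (hms k 1).add (hms k (-1)),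
          Finset.mul_sum]
        refine Finset.sum_congr rfl fun k _ => ?_
        rw [lintegral_add_left (hms k 1), mul_add]
    _ ≤ ENNReal.ofReal (9 * δ ^ 2) * ∫⁻ X, (shellPair a δ i j).indicator
          (fun X => ∑ k : Fin 3, g k X) X := by
        refine mul_le_mul' le_rfl (lintegral_mono fun X => ?_)
        by_cases hX : X ∈ shellPair a δ i j
        · rw [indicator_of_mem hX]
          refine Finset.sum_le_sum fun k _ => ?_
          have := indicator_shellPairSign_add_le (a := a) (δ := δ) i j k (g k) X
          rwa [indicator_of_mem hX] at this
        · have h1 : ∀ k σ, X ∉ shellPairSign a δ i j k σ := fun k σ h => hX h.1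
          simp [indicator_of_notMem hX, indicator_of_notMem (h1 _ _)]

/-- The `i`-th block of the kinetic density: `∑ₖ |∂_{ik} ψ|² ≤ |∇ψ|²`. [folklore] -/
theorem sum_fderiv_unitVec_le_kineticDensity (ψ : Config N → ℂ) (i : Fin N) (X : Config N) :
    ∑ k : Fin 3, (‖fderiv ℝ ψ X (unitVec i k)‖₊ : ℝ≥0∞) ^ 2 ≤ kineticDensity ψ X := by
  unfold kineticDensity
  exact Finset.single_le_sum (f := fun i' : Fin N => ∑ k : Fin 3,
    (‖fderiv ℝ ψ X (Pi.single i' (EuclideanSpace.single k (1 : ℝ)))‖₊ : ℝ≥0∞) ^ 2)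
    (fun _ _ => zero_le) (Finset.mem_univ i)

/-- **The wall-shell estimate with the full kinetic density**: under the hypotheses of
`lintegral_wallShell_le`, `∫ 1{a < |xᵢ-xⱼ| < a+δ} |ψ|² ≤ 9 δ² ∫ 1{a < |xᵢ-xⱼ| < a+δ} |∇ψ|²`.
[folklore] -/
theorem lintegral_wallShell_le_kinetic (ha : 0 < a) (hδ : 0 < δ) (hδa : 20 * δ ≤ a)
    (har : a ≤ r₀) (hra : r₀ ≤ a + δ) {ψ : Config N → ℂ} (hψ : ContDiff ℝ 1 ψ) {i j : Fin N}
    (hij : i ≠ j) (hzero : ∀ X : Config N, dist (X i) (X j) = r₀ → ψ X = 0) :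
    ∫⁻ X, (shellPair a δ i j).indicator (fun X => (‖ψ X‖₊ : ℝ≥0∞) ^ 2) X ≤
      ENNReal.ofReal (9 * δ ^ 2) * ∫⁻ X, (shellPair a δ i j).indicator (kineticDensity ψ) X := by
  refine (lintegral_wallShell_le ha hδ hδa har hra hψ hij hzero).trans
    (mul_le_mul' le_rfl (lintegral_mono fun X => ?_))
  refine indicator_le_indicator' fun _ => ?_
  exact sum_fderiv_unitVec_le_kineticDensity ψ i X

/-! ### The union of the pair shells (the wall layer) -/

/-- The union over the ordered pairs of the shells `a < |xᵢ - xⱼ| < a + w` (the layer of width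
`w` of configurations with SOME pair in the shell) is measurable. [folklore] -/
theorem measurableSet_pairShells (a w : ℝ) :
    MeasurableSet {Y : Config N | ∃ i j : Fin N, i ≠ j ∧ Y ∈ shellPair a w i j} := by
  simp only [setOf_exists, setOf_and, setOf_mem_eq]
  exact MeasurableSet.iUnion fun i => MeasurableSet.iUnion fun j =>
    (MeasurableSet.const _).inter (measurableSet_shellPair a w i j)

/-- Covering of the layer by the double sum over the ordered pairs:
`1_{some pair in the shell} F ≤ ∑ᵢ ∑_{j ≠ i} 1_{shell_{ij}} F`. [folklore] -/
theorem indicator_pairShells_le (a w : ℝ) (F : Config N → ℝ≥0∞) (X : Config N) :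
    {Y : Config N | ∃ i j : Fin N, i ≠ j ∧ Y ∈ shellPair a w i j}.indicator F X ≤
      ∑ i : Fin N, ∑ j ∈ Finset.univ.erase i, (shellPair a w i j).indicator F X := by
  by_cases hX : X ∈ {Y : Config N | ∃ i j : Fin N, i ≠ j ∧ Y ∈ shellPair a w i j}
  · rw [indicator_of_mem hX]
    obtain ⟨i, j, hij, hXs⟩ := hX
    -- adapted from `CutState.le_sum_shell` of …GroundStateRigidityStubCutStateBound.lean
    calc F X = (shellPair a w i j).indicator F X := (indicator_of_mem hXs F).symm
      _ ≤ ∑ j' ∈ Finset.univ.erase i, (shellPair a w i j').indicator F X :=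
          Finset.single_le_sum (f := fun j' => (shellPair a w i j').indicator F X)
            (fun _ _ => zero_le) (Finset.mem_erase.2 ⟨hij.symm, Finset.mem_univ j⟩)
      _ ≤ _ := Finset.single_le_sum
            (f := fun i' => ∑ j' ∈ Finset.univ.erase i', (shellPair a w i' j').indicator F X)
            (fun _ _ => zero_le) (Finset.mem_univ i)
  · rw [indicator_of_notMem hX]
    exact zero_le

/-- The integrated covering: `∫ 1_{some pair in the shell} F ≤ ∑ᵢ ∑_{j ≠ i} ∫ 1_{shell_{ij}} F`.
[folklore] -/
theorem lintegral_pairShells_le (a w : ℝ) {F : Config N → ℝ≥0∞} (hF : Measurable F) :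
    ∫⁻ X, {Y : Config N | ∃ i j : Fin N, i ≠ j ∧ Y ∈ shellPair a w i j}.indicator F X ≤
      ∑ i : Fin N, ∑ j ∈ Finset.univ.erase i, ∫⁻ X, (shellPair a w i j).indicator F X := by
  calc _ ≤ ∫⁻ X, ∑ i : Fin N, ∑ j ∈ Finset.univ.erase i, (shellPair a w i j).indicator F X :=
        lintegral_mono fun X => indicator_pairShells_le a w F X
    _ = _ := by
        rw [lintegral_finsetSum _ fun i _ => Finset.measurable_sum _ fun j _ =>
          hF.indicator (measurableSet_shellPair a w i j)]
        exact Finset.sum_congr rfl fun i _ =>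
          lintegral_finsetSum _ fun j _ => hF.indicator (measurableSet_shellPair a w i j)

/-- **Mass in the wall layer.** If the `C¹` wave function `ψ` vanishes wherever SOME pair is at
distance exactly `r₀`, `a ≤ r₀ ≤ a + δ`, `0 < δ ≤ a/20`, then its mass in the layer
`{∃ i ≠ j, a < |xᵢ - xⱼ| < a + δ}` is at most `N² · 9δ²` times its kinetic energy in the same
layer (one-pair wall-shell estimates summed over the ordered pairs). [folklore] -/
theorem lintegral_wallLayer_le (ha : 0 < a) (hδ : 0 < δ) (hδa : 20 * δ ≤ a) (har : a ≤ r₀)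
    (hra : r₀ ≤ a + δ) {ψ : Config N → ℂ} (hψ : ContDiff ℝ 1 ψ)
    (hzero : ∀ (X : Config N) (i j : Fin N), i ≠ j → dist (X i) (X j) = r₀ → ψ X = 0) :
    ∫⁻ X, {Y : Config N | ∃ i j : Fin N, i ≠ j ∧ Y ∈ shellPair a δ i j}.indicator
        (fun Y => (‖ψ Y‖₊ : ℝ≥0∞) ^ 2) X ≤
      (N : ℝ≥0∞) * ((N : ℝ≥0∞) * (ENNReal.ofReal (9 * δ ^ 2) *
        ∫⁻ X, {Y : Config N | ∃ i j : Fin N, i ≠ j ∧ Y ∈ shellPair a δ i j}.indicator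
          (kineticDensity ψ) X)) := by
  refine (lintegral_pairShells_le a δ (measurable_ennnormSq hψ.continuous)).trans
    (ClosedEnergyTrunc.sum_sum_le fun i j hij => ?_)
  refine (lintegral_wallShell_le_kinetic ha hδ hδa har hra hψ hij
    (fun X hX => hzero X i j hij hX)).trans (mul_le_mul' le_rfl (lintegral_mono fun X => ?_))
  exact indicator_le_indicator_of_subset
    (show shellPair a δ i j ⊆ {Y : Config N | ∃ i j : Fin N, i ≠ j ∧ Y ∈ shellPair a δ i j} from
      fun Y hY => ⟨i, j, hij, hY⟩) (fun _ => zero_le) X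

end WallCut

end Summit.AtomisticToContinuum.BoseEinsteinCondensation.Theorems.GroundStateRigidity

end
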